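import Mathlib
import Summits.QuantumFields.YangMills.Theorems.TransportFieldVacuumDerivativeLinear
import Summits.QuantumFields.YangMills.Theorems.FemtoTransferGapSlabFlowLift
import HarnessLib

/-!
# Crux `TransportFieldFano.TransportKineticCeiling` ⟨stmt-QuantumFields-23354⟩, line `birth` (planner ym-idea-4 g17): the registered stub
# `stub_linearSplit` — CLOSED, via the transport-field regularity kit

`LinearSplitP`: with `Y^vψ(U) = Σ_x d/dt|₀ ψ(U[(x,0) ↦ U_{(x,0)} expPauli(t v_x(U))])`, the window field `b∘W` splits as the own-axis coherent
field `b∘P` plus the remainder `r = b∘W − b∘P`, and `‖Y^{b∘W}Ω‖² ≤ 2‖Y^{b∘P}Ω‖² + 2‖Y^{r}Ω‖²`.  This is NOT formal bookkeeping: it needs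
(i) ADDITIVITY of the vacuum's directional derivative in the direction (`TransportField.deriv_vacuum_rightShift_add`, tranche 3b — the
vacuum is `C¹` along one-link shifts by Feynman–Hellmann, tranches 1–2) and (ii) square-integrability of the three `Y`-fields, which are
continuous on the compact configuration space because the direction fields `b∘P`, `b∘W` are (`TransportField.continuous_deriv_vacuum_rightShift`).
HONEST FRAMING: the crux `TransportKineticCeiling` (its Fisher-information stubs) is OPEN; K2a and the YM mass gap are NOT proved.  No `sorry`,
no new axiom; the `abbrev` is a registered-stub copy (verbatim), not a citable fact.  References: [cite: ReedSimonIV1978, Thm. XIII.43];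
[cite: Balaban1985UV3, p. 260].
-/

set_option autoImplicit false

noncomputable section

open MeasureTheory Filter Topology
open scoped BigOperators
open Literature.MathematicalPhysics.QuantumFieldTheory (GaugeConfig Site Edge)
open Literature.MathematicalPhysics.QuantumLattice (secondCountableTopology_su2)
open Literature.MathematicalPhysics.QuantumFieldTheory.Balaban1983to89.B10Eq18SigmaSU2 (pauli)
open Literature.MathematicalPhysics.QuantumFieldTheory.Balaban1983to89.B10Eq18SigmaSU2Haar (expPauli)
open Summit.QuantumFields.YangMills.Theorems.EquipartitionPinsProbe.TangentSteinFiniteBeta (exists_abs_le_of_continuous)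

namespace Summit.QuantumFields.YangMills.Theorems.TransportFieldFano

open Summit.QuantumFields.YangMills.Theorems.FemtoTransferGap
open Summit.QuantumFields.YangMills.Theorems.TransportField

variable {L : ℕ} [NeZero L]

/-! ## §1 Continuity of the direction fields -/

/-- The colour-vector map `b(w) = Re tr w · (Re(−i/2 · tr(σ_i w)))_i : SU(2) → ℝ³` is continuous. [folklore] -/
theorem continuous_colourVec :
    Continuous fun w : SU2 => (EuclideanSpace.equiv (Fin 3) ℝ).symm fun i =>
      (su2Rep w).trace.re * (-(Complex.I / 2) * (pauli i * su2Rep w).trace).re := by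
  refine (EuclideanSpace.equiv (Fin 3) ℝ).symm.continuous.comp ?_
  refine continuous_pi fun i => ?_
  have h1 : Continuous fun w : SU2 => (su2Rep w).trace.re := Complex.continuous_re.comp continuous_su2Rep.matrix_trace
  have h2 : Continuous fun w : SU2 => (-(Complex.I / 2) * (pauli i * su2Rep w).trace).re :=
    Complex.continuous_re.comp (continuous_const.mul (continuous_const.mul continuous_su2Rep).matrix_trace)
  exact h1.mul h2

omit [NeZero L] in
/-- One entry of the Polyakov triple, `U ↦ (polyakovSite y U) e`, is continuous. [folklore] -/
theorem continuous_polyakovSite_apply (y : Site 3 L) (e : Edge 3 1) :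
    Continuous fun U : GaugeConfig 3 L SU2 => polyakovSite y U e := by
  have h := continuous_polyakovSite (G := SU2) (L := L) y
  exact (continuous_apply e).comp h

omit [NeZero L] in
/-- The own-axis Polyakov holonomy `U ↦ P₀(x+ê₀)` is continuous. [folklore] -/
theorem continuous_axisHolonomy (x : Site 3 L) :
    Continuous fun U : GaugeConfig 3 L SU2 => polyakovSite (x.shift 0) U ((0 : Site 3 1), (0 : Fin 3)) :=
  continuous_polyakovSite_apply (x.shift 0) _

omit [NeZero L] in
/-- The window holonomy `U ↦ U_{(x+ê₀,1)} P₀(x+ê₀+ê₁) U_{(x+ê₀,1)}⁻¹` is continuous. [folklore] -/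
theorem continuous_windowHolonomy (x : Site 3 L) :
    Continuous fun U : GaugeConfig 3 L SU2 =>
      U (x.shift 0, (1 : Fin 3)) * polyakovSite ((x.shift 0).shift 1) U ((0 : Site 3 1), (0 : Fin 3)) * (U (x.shift 0, (1 : Fin 3)))⁻¹ := by
  have h1 : Continuous fun U : GaugeConfig 3 L SU2 => U (x.shift 0, (1 : Fin 3)) := continuous_apply _
  have h2 := continuous_polyakovSite_apply (L := L) ((x.shift 0).shift 1) ((0 : Site 3 1), (0 : Fin 3))
  exact (h1.mul h2).mul h1.inv

/-! ## §2 Square-integral algebra for bounded continuous functions -/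

/-- `∫(u+v)² ≤ 2∫u² + 2∫v²` for continuous `u, v` on the compact configuration space (as `l2` self-pairings). [folklore] -/
theorem l2_add_self_le {u v : GaugeConfig 3 L SU2 → ℝ} (hu : Continuous u) (hv : Continuous v) :
    l2 (fun U => u U + v U) (fun U => u U + v U) ≤ 2 * l2 u u + 2 * l2 v v := by
  haveI : SecondCountableTopology SU2 := secondCountableTopology_su2
  haveI : IsProbabilityMeasure (configMeasure SU2 L) := by unfold configMeasure; infer_instance
  obtain ⟨Cu, -, hCu⟩ := exists_abs_le_of_continuous hu
  obtain ⟨Cv, -, hCv⟩ := exists_abs_le_of_continuous hv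
  have hint : ∀ {f g : GaugeConfig 3 L SU2 → ℝ}, Continuous f → Continuous g → ∀ Cf Cg : ℝ, (∀ U, |f U| ≤ Cf) → (∀ U, |g U| ≤ Cg) →
      Integrable (fun U => f U * g U) (configMeasure SU2 L) := by
    intro f g hf hg Cf Cg hCf hCg
    refine Integrable.of_bound (hf.mul hg).measurable.aestronglyMeasurable (Cf * Cg) (ae_of_all _ fun U => ?_)
    rw [Real.norm_eq_abs, abs_mul]
    exact mul_le_mul (hCf U) (hCg U) (abs_nonneg _) ((abs_nonneg _).trans (hCf U))
  have huu := hint hu hu Cu Cu hCu hCu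
  have hvv := hint hv hv Cv Cv hCv hCv
  unfold l2
  calc ∫ U, (u U + v U) * (u U + v U) ∂configMeasure SU2 L
      ≤ ∫ U, (2 * (u U * u U) + 2 * (v U * v U)) ∂configMeasure SU2 L := by
        refine integral_mono ?_ ((huu.const_mul 2).add (hvv.const_mul 2)) fun U => ?_
        · have h := hint (hu.add hv) (hu.add hv) (Cu + Cv) (Cu + Cv)
            (fun U => (abs_add_le _ _).trans (add_le_add (hCu U) (hCv U))) (fun U => (abs_add_le _ _).trans (add_le_add (hCu U) (hCv U)))
          exact h
        · dsimp only
          nlinarith [sq_nonneg (u U - v U)]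
    _ = 2 * ∫ U, u U * u U ∂configMeasure SU2 L + 2 * ∫ U, v U * v U ∂configMeasure SU2 L := by
        rw [integral_add (huu.const_mul 2) (hvv.const_mul 2), integral_const_mul, integral_const_mul]

/-! ## §3 The registered stub -/

/-- The registered stub statement `LinearSplitP` of line `birth` of crux ⟨stmt-QuantumFields-23354⟩ (verbatim copy of the skeleton's
`BirthTKC.LinearSplitP`; a registered-stub copy, not a citable fact). -/
abbrev LinearSplitP : Prop :=
  ∀ β : ℝ, 0 < β → ∀ (L : ℕ) [NeZero L], ∀ Ω : Literature.MathematicalPhysics.QuantumFieldTheory.GaugeConfig 3 L SU2 → ℝ, IsPhys Ω → l2 Ω Ω = 1 → transferApply β Ω = topValue su2Rep L β • Ω → let W : Literature.MathematicalPhysics.QuantumFieldTheory.Site 3 L → Literature.MathematicalPhysics.QuantumFieldTheory.GaugeConfig 3 L SU2 → SU2 := fun x U => U (x.shift 0, (1 : Fin 3)) * polyakovSite ((x.shift 0).shift 1) U ((0 : Literature.MathematicalPhysics.QuantumFieldTheory.Site 3 1), (0 : Fin 3)) * (U (x.shift 0, (1 : Fin 3)))⁻¹; let b : SU2 → EuclideanSpace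 ℝ (Fin 3) := fun w => (EuclideanSpace.equiv (Fin 3) ℝ).symm fun i => (su2Rep w).trace.re * (-(Complex.I / 2) * (Literature.MathematicalPhysics.QuantumFieldTheory.Balaban1983to89.B10Eq18SigmaSU2.pauli i * su2Rep w).trace).re; let P : Literature.MathematicalPhysics.QuantumFieldTheory.Site 3 L → Literature.MathematicalPhysics.QuantumFieldTheory.GaugeConfig 3 L SU2 → SU2 := fun x U => polyakovSite (x.shift 0) U ((0 : Literature.MathematicalPhysics.QuantumFieldTheory.Site 3 1), (0 : Fin 3)); let Y : (Literature.MathematicalPhysics.QuantumFieldTheory.Site 3 L → Literature.MathematicalPhysics.QuantumFieldTheory.GaugeConfig 3 L SU2 → EuclideanSpace ℝ (Fin 3)) → (Literature.MathematicalPhysics.QuantumFieldTheory.GaugeConfig 3 L SU2 → ℝ) → Literature.MathematicalPhysics.QuantumFieldTheory.GaugeConfig 3 L SU2 → ℝ := fun v ψ U => ∑ x : Literature.MathematicalPhysics.QuantumFieldTheory.Site 3 L, deriv (fun t : ℝ => ψ (Function.update U (x, (0 : Fin 3)) (U (x, (0 : Fin 3)) * Literature.MathematicalPhysics.QuantumFieldTheory.Balaban1983to89.B10Eq18SigmaSU2Haar.expPauli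 (t • v x U)))) 0; l2 (Y (fun x U => b (W x U)) Ω) (Y (fun x U => b (W x U)) Ω) ≤ 2 * l2 (Y (fun x U => b (P x U)) Ω) (Y (fun x U => b (P x U)) Ω) + 2 * l2 (Y (fun x U => b (W x U) - b (P x U)) Ω) (Y (fun x U => b (W x U) - b (P x U)) Ω)

/-- ★★ **`stub_linearSplit`** (registered stub of the birth skeleton of crux ⟨stmt-QuantumFields-23354⟩, signature `LinearSplitP` verbatim):
`‖Y^{b∘W}Ω‖² ≤ 2‖Y^{b∘P}Ω‖² + 2‖Y^{b∘W − b∘P}Ω‖²`, by direction-additivity of the vacuum's one-link derivatives (regularity kit) and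
`(u+v)² ≤ 2u² + 2v²`. [cite: ReedSimonIV1978, Thm. XIII.43] [cite: Balaban1985UV3, p. 260] -/
theorem stub_linearSplit : LinearSplitP := by
  intro β _hβ L _ Ω hΩ _hn heig
  dsimp only
  -- continuity of the two direction fields at each base site
  have hbP : ∀ x : Site 3 L, Continuous fun U : GaugeConfig 3 L SU2 =>
      (EuclideanSpace.equiv (Fin 3) ℝ).symm fun i =>
        (su2Rep (polyakovSite (x.shift 0) U ((0 : Site 3 1), (0 : Fin 3)))).trace.re *
          (-(Complex.I / 2) * (pauli i * su2Rep (polyakovSite (x.shift 0) U ((0 : Site 3 1), (0 : Fin 3)))).trace).re :=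
    fun x => continuous_colourVec.comp (continuous_axisHolonomy x)
  have hbR : ∀ x : Site 3 L, Continuous fun U : GaugeConfig 3 L SU2 =>
      ((EuclideanSpace.equiv (Fin 3) ℝ).symm fun i =>
        (su2Rep (U (x.shift 0, (1 : Fin 3)) * polyakovSite ((x.shift 0).shift 1) U ((0 : Site 3 1), (0 : Fin 3)) *
            (U (x.shift 0, (1 : Fin 3)))⁻¹)).trace.re *
          (-(Complex.I / 2) * (pauli i * su2Rep (U (x.shift 0, (1 : Fin 3)) * polyakovSite ((x.shift 0).shift 1) U
            ((0 : Site 3 1), (0 : Fin 3)) * (U (x.shift 0, (1 : Fin 3)))⁻¹)).trace).re) -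
      (EuclideanSpace.equiv (Fin 3) ℝ).symm fun i =>
        (su2Rep (polyakovSite (x.shift 0) U ((0 : Site 3 1), (0 : Fin 3)))).trace.re *
          (-(Complex.I / 2) * (pauli i * su2Rep (polyakovSite (x.shift 0) U ((0 : Site 3 1), (0 : Fin 3)))).trace).re :=
    fun x => (continuous_colourVec.comp (continuous_windowHolonomy x)).sub (hbP x)
  -- the two summed derivative fields are continuous
  have hu : Continuous fun U : GaugeConfig 3 L SU2 => ∑ x : Site 3 L,
      deriv (fun t : ℝ => Ω (Function.update U (x, (0 : Fin 3)) (U (x, (0 : Fin 3)) * expPauli (t •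
        (EuclideanSpace.equiv (Fin 3) ℝ).symm fun i =>
          (su2Rep (polyakovSite (x.shift 0) U ((0 : Site 3 1), (0 : Fin 3)))).trace.re *
            (-(Complex.I / 2) * (pauli i * su2Rep (polyakovSite (x.shift 0) U ((0 : Site 3 1), (0 : Fin 3)))).trace).re)))) 0 :=
    continuous_finsetSum _ fun x _ => continuous_deriv_vacuum_rightShift β (x, (0 : Fin 3)) (hbP x) hΩ heig
  have hv : Continuous fun U : GaugeConfig 3 L SU2 => ∑ x : Site 3 L,
      deriv (fun t : ℝ => Ω (Function.update U (x, (0 : Fin 3)) (U (x, (0 : Fin 3)) * expPauli (t •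
        (((EuclideanSpace.equiv (Fin 3) ℝ).symm fun i =>
          (su2Rep (U (x.shift 0, (1 : Fin 3)) * polyakovSite ((x.shift 0).shift 1) U ((0 : Site 3 1), (0 : Fin 3)) *
              (U (x.shift 0, (1 : Fin 3)))⁻¹)).trace.re *
            (-(Complex.I / 2) * (pauli i * su2Rep (U (x.shift 0, (1 : Fin 3)) * polyakovSite ((x.shift 0).shift 1) U
              ((0 : Site 3 1), (0 : Fin 3)) * (U (x.shift 0, (1 : Fin 3)))⁻¹)).trace).re) -
        (EuclideanSpace.equiv (Fin 3) ℝ).symm fun i =>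
          (su2Rep (polyakovSite (x.shift 0) U ((0 : Site 3 1), (0 : Fin 3)))).trace.re *
            (-(Complex.I / 2) * (pauli i * su2Rep (polyakovSite (x.shift 0) U ((0 : Site 3 1), (0 : Fin 3)))).trace).re))))) 0 :=
    continuous_finsetSum _ fun x _ => continuous_deriv_vacuum_rightShift β (x, (0 : Fin 3)) (hbR x) hΩ heig
  -- pointwise split `Y^{bW} = Y^{bP} + Y^{r}`
  have hsplit := l2_add_self_le hu hv
  refine le_of_eq_of_le ?_ hsplit
  congr 1 <;>
  · funext U
    rw [← Finset.sum_add_distrib]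
    refine Finset.sum_congr rfl fun x _ => ?_
    have h := deriv_vacuum_rightShift_add β (x, (0 : Fin 3))
      ((EuclideanSpace.equiv (Fin 3) ℝ).symm fun i =>
        (su2Rep (polyakovSite (x.shift 0) U ((0 : Site 3 1), (0 : Fin 3)))).trace.re *
          (-(Complex.I / 2) * (pauli i * su2Rep (polyakovSite (x.shift 0) U ((0 : Site 3 1), (0 : Fin 3)))).trace).re)
      (((EuclideanSpace.equiv (Fin 3) ℝ).symm fun i =>
        (su2Rep (U (x.shift 0, (1 : Fin 3)) * polyakovSite ((x.shift 0).shift 1) U ((0 : Site 3 1), (0 : Fin 3)) *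
            (U (x.shift 0, (1 : Fin 3)))⁻¹)).trace.re *
          (-(Complex.I / 2) * (pauli i * su2Rep (U (x.shift 0, (1 : Fin 3)) * polyakovSite ((x.shift 0).shift 1) U
            ((0 : Site 3 1), (0 : Fin 3)) * (U (x.shift 0, (1 : Fin 3)))⁻¹)).trace).re) -
      (EuclideanSpace.equiv (Fin 3) ℝ).symm fun i =>
        (su2Rep (polyakovSite (x.shift 0) U ((0 : Site 3 1), (0 : Fin 3)))).trace.re *
          (-(Complex.I / 2) * (pauli i * su2Rep (polyakovSite (x.shift 0) U ((0 : Site 3 1), (0 : Fin 3)))).trace).re)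
      hΩ heig U
    rw [add_sub_cancel] at h
    exact h

end Summit.QuantumFields.YangMills.Theorems.TransportFieldFano

end
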